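import Literature.Probability.Distributions.HypergeometricRatioWindow
import Literature.Probability.Distributions.PoissonBinomialChernoff
import Literature.Probability.Distributions.LevelZeroShellLawTail
import HarnessLib

/-!
# Even differences of a hypergeometric law on a stencil: the OFF-CENTRE relative bound inside the window
# (good components) and the exponential absolute bound far from the mean (far components)

Measure-free facts about the hypergeometric law in the generating-polynomial currency of the tree,
`H_{b,d,r} = Σ_k C(b,k)C(d,r−k)X^k` (`StablePolynomials.hyperGen`), continuing `PoissonBinomialTilting.lean` §9
(`hyperGen_abs_nabla_even_le`: the pointwise RELATIVE bound for `∇^{2k}h` at the CENTRE of the stencil, by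
exponential tilting [Durrett 2019, §2.7]) and `HypergeometricRatioWindow.lean` (lit g35: on the window
`|x − μ| ≤ L` with margins `2(L+1) ≤ b−μ, r−μ, μ, d−r+μ` the consecutive-atom ratio satisfies
`|1−λ|, |1−λ⁻¹| ≤ η := 4(N+2)(L+1)/W`, two-sided geometric envelopes, `min(λ,λ⁻¹)V ≥ V/(1+η)`, and §6 the stencil
sum `|coeff_n((1−X)^m P)| ≤ Σ_i C(m,i) coeff_{n−i} P`). Throughout `N = b+d`, `μ = rb/N`, `W = rbd(N−r)/N²`,
`V = rbd(N−r)/(N²(N−1))`.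

* §1 `sum_Ico_choose_mul_pow_mul_pow_succ` (the binomial bookkeeping
  `Σ_{j=1}^{2k} C(2k,j) η^{2k−j} Q^{j+1} = Q·((η+Q)^{2k} − η^{2k})`).
* §2 **`hyperGen_abs_nabla_even_le_of_window`** — THE GOOD-COMPONENT BOUND, OFF-CENTRE: for a reference point
  `y` and a stencil top `y + u` (`u ≤ 2k`) whose centre `x₁ = y + u − k` lies, like `y`, in the window, and
  `k(1+η) ≤ V`:
  `|coeff_{y+u}((1−X)^{2k} H_{b,d,r})| ≤ coeff_y(H_{b,d,r}) · ((1+η)(η+Q))^{2k} · (1 + (4(√r+1)/3)·Q)`,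
  `Q = 2√192·√(2(2k+1)(1+η)/V)` — the tree's centred bound at `x₁` (tilting), `|1−λ(x₁)| ≤ η`, `λ(x₁)^{−k} ≤ (1+η)^k`,
  `V' ≥ V/(1+η)`, the envelope `coeff_{x₁} ≤ (1+η)^{|x₁−y|} coeff_y` (`|x₁ − y| ≤ k`), and the binomial theorem.
  Reading: at relative size `((1+η)(η + C√(k/V)))^{2k}·O(√(rk/V))` the `2k`-th difference anywhere on a stencil
  containing `y` is controlled by the atom AT `y` — the shape the pointwise good/far mixture inequality
  (`Combinatorics/Optimization/ShellLawPointwiseMixture`) consumes with a common reference point for all components.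
* §3 **`hyperGen_abs_nabla_shift_le_of_far`** — THE FAR-COMPONENT BOUND for a SHIFTED component `X^σ·H_{b,d,r}`:
  if every local stencil index that is present, `i − σ − l` (`l ≤ m`, `σ + l ≤ i`), is at distance `≥ Λ₁` from
  `μ`, then for every `u ∈ [0,1]`
  `|coeff_i((1−X)^m · X^σ H_{b,d,r})| ≤ 2^m · C(N,r) · exp(u²μ − uΛ₁)`
  — each stencil coefficient is one term of an upper or a lower tail, priced by the parametrised Chernoff bounds
  `hyperGen_upperTail_le_exp_param` / `hyperGen_lowerTail_le_exp_param` (both give `exp(u²μ − uΛ₁)`), and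
  `Σ_l C(m,l) = 2^m`. Also `coeff_hyperGen_le_exp_of_far` (one far coefficient) and the unshifted form.

All PROVED, 0 sorry, no definitions, no named facts; finite real algebra on top of the cited tree lemmas.
Cell pnp-psdrank (prover g24; MEMO-26 §7 Step 3, both sides of the good/far split of the [BULK] input of
Theorems brick 123); nothing here is specific to that cell.

## References
* [Durrett2019] R. Durrett, *Probability: Theory and Examples*, 5th ed. (2019), §2.7 (the tilted distribution;
  used through `hyperGen_abs_nabla_even_le` and the Chernoff bounds).
* [ChattamvelliShanmugam2020] R. Chattamvelli, R. Shanmugam, *Discrete Distributions in Engineering and the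
  Applied Sciences* (2020), §7.4 Table 7.1 (recurrence, mean, variance of the hypergeometric law; used through
  `HypergeometricRatioWindow`).
* [RollinRoss2010] A. Röllin, N. Ross, *Local limit theorems via Landau–Kolmogorov inequalities*, Bernoulli 21
  (2015) 851–880, §3 Lemma 3.1 (differences as coefficients of `(1−X)^m·P`), §4.1 Thm 4.2.
* [VatutinMikhailov1983] V. A. Vatutin, V. G. Mikhailov, Theory Probab. Appl. 27 (1983) 734–743, §2.
-/

namespace Literature.Probability.Distributions

open Finset Polynomial
open Literature.Combinatorics.StablePolynomials (hyperGen coeff_hyperGen coeff_hyperGen_nonneg natDegree_hyperGen_le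
  eval_one_hyperGen)

namespace PoissonBinomial

/-! ## §1 Binomial bookkeeping -/

/-- `Σ_{j=1}^{m} C(m,j)·η^{m−j}·Q^{j+1} = Q·((η+Q)^m − η^m)` (the binomial theorem with the `j = 0` term removed).
[cite: RollinRoss2010, §3 (Lemma 3.1)] -/
theorem sum_Ico_choose_mul_pow_mul_pow_succ (m : ℕ) (η Q : ℝ) :
    ∑ j ∈ Ico 1 (m + 1), (m.choose j : ℝ) * η ^ (m - j) * Q ^ (j + 1) = Q * ((η + Q) ^ m - η ^ m) := by
  have hbin : (Q + η) ^ m = ∑ j ∈ range (m + 1), Q ^ j * η ^ (m - j) * (m.choose j : ℝ) := add_pow Q η m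
  have hsplit := (sum_range_add_sum_Ico (fun j => Q ^ j * η ^ (m - j) * (m.choose j : ℝ))
    (show 1 ≤ m + 1 by omega)).symm
  rw [sum_range_one] at hsplit
  simp only [pow_zero, one_mul, Nat.sub_zero, Nat.choose_zero_right, Nat.cast_one, mul_one] at hsplit
  have hI : ∑ j ∈ Ico 1 (m + 1), (m.choose j : ℝ) * η ^ (m - j) * Q ^ (j + 1) =
      Q * ∑ j ∈ Ico 1 (m + 1), Q ^ j * η ^ (m - j) * (m.choose j : ℝ) := by
    rw [mul_sum]
    refine sum_congr rfl fun j _ => ?_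
    rw [pow_succ]; ring
  rw [hI, add_comm η Q, hbin, hsplit]
  ring

/-- Monotonicity of the bracket: for `0 ≤ η`, `0 ≤ Q`, `η^m + c·Q·((η+Q)^m − η^m) ≤ (η+Q)^m·(1 + c·Q)` (`c ≥ 0`).
[cite: RollinRoss2010, §3 (Lemma 3.1)] -/
theorem pow_add_mul_le_pow_mul (m : ℕ) {η Q c : ℝ} (hη : 0 ≤ η) (hQ : 0 ≤ Q) (hc : 0 ≤ c) :
    η ^ m + c * (Q * ((η + Q) ^ m - η ^ m)) ≤ (η + Q) ^ m * (1 + c * Q) := by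
  have h1 : η ^ m ≤ (η + Q) ^ m := pow_le_pow_left₀ hη (by linarith) m
  have h2 : 0 ≤ (η + Q) ^ m := pow_nonneg (by linarith) m
  have h3 : 0 ≤ c * Q * η ^ m := mul_nonneg (mul_nonneg hc hQ) (pow_nonneg hη m)
  nlinarith [mul_nonneg hc hQ, h1, h2, h3, mul_nonneg (mul_nonneg hc hQ) h2]

/-! ## §2 The good-component bound: even differences anywhere on a stencil through a window point -/

/-- **POINTWISE RELATIVE SMOOTHNESS OF A HYPERGEOMETRIC LAW, OFF-CENTRE, INSIDE THE WINDOW.** Let `μ = rb/N`,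
`W = rbd(N−r)/N²`, `V = rbd(N−r)/(N²(N−1)) > 0`, a window half-width `L` with margins
`2(L+1) ≤ b−μ, r−μ, μ, d−r+μ`, and `η = 4(N+2)(L+1)/W`. For a reference point `y` and a stencil top `y + u` with
`u ≤ 2k`, whose centre `x₁` (`x₁ + k = y + u`) and `y` itself both lie in the window, and `k(1+η) ≤ V`:
`|coeff_{y+u}((1−X)^{2k}·H_{b,d,r})| ≤ coeff_y(H_{b,d,r}) · ((1+η)·(η+Q))^{2k} · (1 + (4(√r+1)/3)·Q)` with
`Q = 2√192·√(2(2k+1)(1+η)/V)`. (The tree's centred tilting bound `hyperGen_abs_nabla_even_le` at `x₁`, the window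
ratio bounds `|1−λ(x₁)|, |1−λ(x₁)⁻¹| ≤ η`, `min(λ,λ⁻¹)V ≥ V/(1+η)`, the envelope from `x₁` to `y`, and
`Σ_{j=1}^{2k} C(2k,j)η^{2k−j}Q^{j+1} = Q((η+Q)^{2k} − η^{2k})`.)
[cite: Durrett2019, §2.7] [cite: ChattamvelliShanmugam2020, §7.4 Table 7.1] [cite: RollinRoss2010, §4.1 Thm 4.2] -/
theorem hyperGen_abs_nabla_even_le_of_window {b d r k u y x₁ : ℕ} {μ L W V : ℝ}
    (hμ : μ = (r : ℝ) * b / ((b : ℝ) + d))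
    (hW : W = (r : ℝ) * b * d * ((b : ℝ) + d - r) / ((b : ℝ) + d) ^ 2)
    (hVdef : V = (r : ℝ) * b * d * ((b : ℝ) + d - r) / (((b : ℝ) + d) ^ 2 * ((b : ℝ) + d - 1)))
    (hV : 0 < V) (hx₁ : x₁ + k = y + u) (hu : u ≤ 2 * k)
    (hy : |(y : ℝ) - μ| ≤ L) (hx₁w : |(x₁ : ℝ) - μ| ≤ L)
    (hbm : 2 * (L + 1) ≤ (b : ℝ) - μ) (hrm : 2 * (L + 1) ≤ (r : ℝ) - μ)
    (hμm : 2 * (L + 1) ≤ μ) (hdm : 2 * (L + 1) ≤ (d : ℝ) - r + μ)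
    (hkV : (k : ℝ) * (1 + 4 * ((b : ℝ) + d + 2) * (L + 1) / W) ≤ V) :
    |((1 - X) ^ (2 * k) * hyperGen b d r).coeff (y + u)| ≤
      (hyperGen b d r).coeff y *
        (((1 + 4 * ((b : ℝ) + d + 2) * (L + 1) / W) *
            (4 * ((b : ℝ) + d + 2) * (L + 1) / W +
              2 * Real.sqrt 192 * Real.sqrt (2 * (2 * (k : ℝ) + 1) *
                (1 + 4 * ((b : ℝ) + d + 2) * (L + 1) / W) / V))) ^ (2 * k) *
          (1 + 4 * (Real.sqrt r + 1) / 3 *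
            (2 * Real.sqrt 192 * Real.sqrt (2 * (2 * (k : ℝ) + 1) *
              (1 + 4 * ((b : ℝ) + d + 2) * (L + 1) / W) / V)))) := by
  set η : ℝ := 4 * ((b : ℝ) + d + 2) * (L + 1) / W with hη
  set Q : ℝ := 2 * Real.sqrt 192 * Real.sqrt (2 * (2 * (k : ℝ) + 1) * (1 + η) / V) with hQ
  set H := hyperGen b d r with hH
  set l : ℝ := ((x₁ : ℝ) + 1) * ((d : ℝ) - r + x₁ + 1) / (((b : ℝ) - x₁) * ((r : ℝ) - x₁)) with hl
  -- support and positivity facts at `x₁`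
  obtain ⟨hxb, hxr, hxd⟩ := window_support hx₁w hbm hrm hdm
  have hr : r ≤ b + d := by omega
  have hL0 : 0 ≤ L := (abs_nonneg _).trans hy
  -- `W > 0` (both centre factors are at least `2(L+1) > 0`)
  have hN : 0 < b + d := by omega
  have hW0 : 0 < W := by
    rw [hW, ← sub_mean_mul_sub_mean_eq hN hμ]
    exact mul_pos (by linarith) (by linarith)
  have hη0 : 0 ≤ η := by rw [hη]; positivity
  have hη1 : 0 < 1 + η := by linarith
  -- the window ratio bounds at `x₁`
  have h1l : |1 - l| ≤ η := abs_one_sub_hyperRatio_le hμ hW hl hx₁w hbm hrm hμm hdm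
  have h1li : |1 - l⁻¹| ≤ η := abs_one_sub_hyperRatio_inv_le hμ hW hl hx₁w hbm hrm hμm hdm
  have hmin : V / (1 + η) ≤ min l l⁻¹ * V := le_min_hyperRatio_inv_mul hμ hW hl hx₁w hbm hrm hμm hdm hV.le
  have hV' : 0 < min l l⁻¹ * V := lt_of_lt_of_le (div_pos hV hη1) hmin
  have hk : (k : ℝ) ≤ min l l⁻¹ * V := by
    refine le_trans ?_ hmin
    rw [le_div_iff₀ hη1]; exact hkV
  have hl0 : 0 < l := by
    rw [hl]
    have hx0 : (0 : ℝ) ≤ x₁ := Nat.cast_nonneg _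
    have hxbR : (x₁ : ℝ) + 2 ≤ b := by exact_mod_cast hxb
    have hxrR : (x₁ : ℝ) + 2 ≤ r := by exact_mod_cast hxr
    have hxdR : (r : ℝ) + 2 ≤ (d : ℝ) + x₁ := by exact_mod_cast hxd
    exact div_pos (mul_pos (by linarith) (by linarith)) (mul_pos (by linarith) (by linarith))
  -- the centred bound at `x₁`
  have hmain := hyperGen_abs_nabla_even_le hr x₁ k (by omega) (by omega) (by omega) hl hVdef hV' hk
  rw [hx₁] at hmain
  -- (a) `coeff x₁ ≤ (1+η)^k · coeff y`
  have hcoef0 : 0 ≤ H.coeff y := coeff_hyperGen_nonneg b d r y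
  have henv : H.coeff x₁ ≤ (1 + η) ^ k * H.coeff y := by
    have h1η : (1 : ℝ) ≤ 1 + η := by linarith
    rcases le_total y x₁ with hyx | hxy
    · have h := (coeff_hyperGen_window_envelope hμ hW hy hx₁w hyx hbm hrm hμm hdm).1
      refine h.trans (mul_le_mul_of_nonneg_right (pow_le_pow_right₀ h1η (by omega)) hcoef0)
    · have h := (coeff_hyperGen_window_envelope hμ hW hx₁w hy hxy hbm hrm hμm hdm).2
      refine h.trans (mul_le_mul_of_nonneg_right (pow_le_pow_right₀ h1η (by omega)) hcoef0)
  -- (b) `λ^{-k} ≤ (1+η)^k`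
  have hlinv : (l ^ k)⁻¹ ≤ (1 + η) ^ k := by
    rw [← inv_pow]
    have hle2 : l⁻¹ ≤ 1 + η := by have := neg_abs_le (1 - l⁻¹); linarith
    exact pow_le_pow_left₀ (inv_pos.2 hl0).le hle2 k
  -- (c)/(d) the bracket: `|1−l|^{2k−j} ≤ η^{2k−j}`, tilted-variance terms `≤ Q^{j+1}`
  have h1l0 : 0 ≤ |1 - l| := abs_nonneg _
  have hQ0 : 0 ≤ Q := by rw [hQ]; positivity
  have hQj : ∀ j ∈ Ico 1 (2 * k + 1),
      (2 * Real.sqrt 192 * Real.sqrt (2 * ((j : ℝ) + 1) / (min l l⁻¹ * V))) ^ (j + 1) ≤ Q ^ (j + 1) := by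
    intro j hj
    have hj2 : j ≤ 2 * k := by have := (mem_Ico.1 hj).2; omega
    refine pow_le_pow_left₀ (by positivity) ?_ (j + 1)
    rw [hQ]
    refine mul_le_mul_of_nonneg_left (Real.sqrt_le_sqrt ?_) (by positivity)
    -- `2(j+1)/V' ≤ 2(2k+1)(1+η)/V`
    have hjk : 2 * ((j : ℝ) + 1) ≤ 2 * (2 * (k : ℝ) + 1) := by
      have : (j : ℝ) ≤ 2 * k := by exact_mod_cast hj2
      linarith
    calc 2 * ((j : ℝ) + 1) / (min l l⁻¹ * V) ≤ 2 * ((j : ℝ) + 1) / (V / (1 + η)) :=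
          div_le_div_of_nonneg_left (by positivity) (div_pos hV hη1) hmin
      _ = 2 * ((j : ℝ) + 1) * (1 + η) / V := by field_simp
      _ ≤ 2 * (2 * (k : ℝ) + 1) * (1 + η) / V := by
          refine div_le_div_of_nonneg_right ?_ hV.le
          exact mul_le_mul_of_nonneg_right hjk hη1.le
  have hbracket : |1 - l| ^ (2 * k) + 4 * (Real.sqrt r + 1) / 3 *
      ∑ j ∈ Ico 1 (2 * k + 1), ((2 * k).choose j : ℝ) * |1 - l| ^ (2 * k - j) *
        (2 * Real.sqrt 192 * Real.sqrt (2 * ((j : ℝ) + 1) / (min l l⁻¹ * V))) ^ (j + 1) ≤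
      (η + Q) ^ (2 * k) * (1 + 4 * (Real.sqrt r + 1) / 3 * Q) := by
    have hc0 : (0 : ℝ) ≤ 4 * (Real.sqrt r + 1) / 3 := by positivity
    have hsum : ∑ j ∈ Ico 1 (2 * k + 1), ((2 * k).choose j : ℝ) * |1 - l| ^ (2 * k - j) *
        (2 * Real.sqrt 192 * Real.sqrt (2 * ((j : ℝ) + 1) / (min l l⁻¹ * V))) ^ (j + 1) ≤
        ∑ j ∈ Ico 1 (2 * k + 1), ((2 * k).choose j : ℝ) * η ^ (2 * k - j) * Q ^ (j + 1) := by
      refine sum_le_sum fun j hj => ?_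
      refine mul_le_mul (mul_le_mul_of_nonneg_left (pow_le_pow_left₀ h1l0 h1l _) (Nat.cast_nonneg _))
        (hQj j hj) (by positivity) (by positivity)
    rw [sum_Ico_choose_mul_pow_mul_pow_succ] at hsum
    have hpow : |1 - l| ^ (2 * k) ≤ η ^ (2 * k) := pow_le_pow_left₀ h1l0 h1l _
    calc _ ≤ η ^ (2 * k) + 4 * (Real.sqrt r + 1) / 3 * (Q * ((η + Q) ^ (2 * k) - η ^ (2 * k))) :=
          add_le_add hpow (mul_le_mul_of_nonneg_left hsum hc0)
      _ ≤ (η + Q) ^ (2 * k) * (1 + 4 * (Real.sqrt r + 1) / 3 * Q) := pow_add_mul_le_pow_mul _ hη0 hQ0 hc0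
  -- assemble
  have hbr0 : 0 ≤ |1 - l| ^ (2 * k) + 4 * (Real.sqrt r + 1) / 3 *
      ∑ j ∈ Ico 1 (2 * k + 1), ((2 * k).choose j : ℝ) * |1 - l| ^ (2 * k - j) *
        (2 * Real.sqrt 192 * Real.sqrt (2 * ((j : ℝ) + 1) / (min l l⁻¹ * V))) ^ (j + 1) := by positivity
  calc |((1 - X) ^ (2 * k) * H).coeff (y + u)|
      ≤ H.coeff x₁ * (l ^ k)⁻¹ * (|1 - l| ^ (2 * k) + 4 * (Real.sqrt r + 1) / 3 *
          ∑ j ∈ Ico 1 (2 * k + 1), ((2 * k).choose j : ℝ) * |1 - l| ^ (2 * k - j) *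
            (2 * Real.sqrt 192 * Real.sqrt (2 * ((j : ℝ) + 1) / (min l l⁻¹ * V))) ^ (j + 1)) := hmain
    _ ≤ ((1 + η) ^ k * H.coeff y) * (1 + η) ^ k * ((η + Q) ^ (2 * k) * (1 + 4 * (Real.sqrt r + 1) / 3 * Q)) := by
        refine mul_le_mul (mul_le_mul henv hlinv (by positivity) (by positivity)) hbracket hbr0 (by positivity)
    _ = H.coeff y * (((1 + η) * (η + Q)) ^ (2 * k) * (1 + 4 * (Real.sqrt r + 1) / 3 * Q)) := by
        have h2k : (1 + η) ^ (2 * k) = (1 + η) ^ k * (1 + η) ^ k := by rw [← pow_add, two_mul]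
        rw [mul_pow, h2k]
        ring

/-! ## §3 The far-component bound: a stencil far from the mean costs `2^m` times an exponential tail -/

/-- **One far coefficient**: if `|x − μ| ≥ Λ₁ ≥ 0` then for every `u ∈ [0,1]`,
`coeff_x(H_{b,d,r}) ≤ C(N,r)·exp(u²μ − uΛ₁)` — the coefficient is one term of the upper tail `Σ_{k ≥ μ+Λ₁}` or of
the lower tail `Σ_{k ≤ μ−Λ₁}`, and both parametrised Chernoff bounds give `exp(u²μ − uΛ₁)`.
[cite: Durrett2019, §2.7 (the tilted distribution; Chernoff's bound)] [cite: VatutinMikhailov1983, §2] -/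
theorem coeff_hyperGen_le_exp_of_far {b d r x : ℕ} (hr : r ≤ b + d) {μ Λ₁ u : ℝ}
    (hμ : μ = (r : ℝ) * b / ((b : ℝ) + d)) (hΛ : Λ₁ ≤ |(x : ℝ) - μ|) (hu0 : 0 ≤ u) (hu1 : u ≤ 1) :
    (hyperGen b d r).coeff x ≤ (((b + d).choose r : ℕ) : ℝ) * Real.exp (u ^ 2 * μ - u * Λ₁) := by
  by_cases hxr : x ≤ r
  · have hxmem : x ∈ range (r + 1) := mem_range.2 (Nat.lt_succ_of_le hxr)
    rcases le_or_gt 0 ((x : ℝ) - μ) with hpos | hneg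
    · -- upper tail from `θ = μ + Λ₁`
      rw [abs_of_nonneg hpos] at hΛ
      have hmemf : x ∈ (range (r + 1)).filter (fun k : ℕ => μ + Λ₁ ≤ (k : ℝ)) :=
        mem_filter.2 ⟨hxmem, by linarith⟩
      have hsingle : (hyperGen b d r).coeff x ≤
          ∑ k ∈ (range (r + 1)).filter (fun k : ℕ => μ + Λ₁ ≤ (k : ℝ)), (hyperGen b d r).coeff k :=
        single_le_sum (fun k _ => coeff_hyperGen_nonneg b d r k) hmemf
      have htail := hyperGen_upperTail_le_exp_param hr hu0 hu1 (μ + Λ₁)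
      rw [← hμ] at htail
      refine hsingle.trans (htail.trans (le_of_eq ?_))
      congr 1; congr 1; ring
    · -- lower tail up to `θ = μ − Λ₁`
      rw [abs_of_neg hneg] at hΛ
      have hmemf : x ∈ (range (r + 1)).filter (fun k : ℕ => (k : ℝ) ≤ μ - Λ₁) :=
        mem_filter.2 ⟨hxmem, by linarith⟩
      have hsingle : (hyperGen b d r).coeff x ≤
          ∑ k ∈ (range (r + 1)).filter (fun k : ℕ => (k : ℝ) ≤ μ - Λ₁), (hyperGen b d r).coeff k :=
        single_le_sum (fun k _ => coeff_hyperGen_nonneg b d r k) hmemf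
      have htail := hyperGen_lowerTail_le_exp_param hr hu0 hu1 (μ - Λ₁)
      rw [← hμ] at htail
      refine hsingle.trans (htail.trans (le_of_eq ?_))
      congr 1; congr 1; ring
  · rw [coeff_hyperGen, if_neg hxr]
    positivity

/-- **THE FAR-COMPONENT BOUND for a shifted hypergeometric component `X^σ·H_{b,d,r}`.** If every local stencil
index that is present — `i − σ − l` with `l ≤ m` and `σ + l ≤ i` — lies at distance `≥ Λ₁` from the mean `μ = rb/N`,
then for every `u ∈ [0,1]`: `|coeff_i((1−X)^m · X^σ·H_{b,d,r})| ≤ 2^m · C(N,r) · exp(u²μ − uΛ₁)`.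
(`(1−X)^m·X^σ H = X^σ·(1−X)^m H`; the stencil sum `Σ_l C(m,l)·coeff_{i−σ−l}`; one far coefficient at a time;
`Σ_l C(m,l) = 2^m`.) [cite: Durrett2019, §2.7] [cite: RollinRoss2010, §3 (Lemma 3.1)] [cite: VatutinMikhailov1983, §2] -/
theorem hyperGen_abs_nabla_shift_le_of_far {b d r : ℕ} (hr : r ≤ b + d) (σ i m : ℕ) {μ Λ₁ u : ℝ}
    (hμ : μ = (r : ℝ) * b / ((b : ℝ) + d)) (hu0 : 0 ≤ u) (hu1 : u ≤ 1)
    (hfar : ∀ l, l ≤ m → σ + l ≤ i → Λ₁ ≤ |(((i - σ - l : ℕ) : ℝ)) - μ|) :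
    |((1 - X) ^ m * (X ^ σ * hyperGen b d r)).coeff i| ≤
      2 ^ m * ((((b + d).choose r : ℕ) : ℝ) * Real.exp (u ^ 2 * μ - u * Λ₁)) := by
  set B : ℝ := (((b + d).choose r : ℕ) : ℝ) * Real.exp (u ^ 2 * μ - u * Λ₁) with hB
  have hB0 : 0 ≤ B := by positivity
  rw [show (1 - X : ℝ[X]) ^ m * (X ^ σ * hyperGen b d r) = X ^ σ * ((1 - X) ^ m * hyperGen b d r) by ring,
    coeff_X_pow_mul']
  split_ifs with hσ
  · -- the stencil sum, one far coefficient at a time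
    have hle := abs_coeff_one_sub_X_pow_mul_le_sum (hyperGen b d r) (coeff_hyperGen_nonneg b d r) m (i - σ)
    refine hle.trans ?_
    have hterm : ∀ l ∈ range (m + 1), (m.choose l : ℝ) *
        (if l ≤ i - σ then (hyperGen b d r).coeff (i - σ - l) else 0) ≤ (m.choose l : ℝ) * B := by
      intro l hl
      refine mul_le_mul_of_nonneg_left ?_ (Nat.cast_nonneg _)
      split_ifs with hli
      · exact coeff_hyperGen_le_exp_of_far hr hμ
          (hfar l (Nat.lt_succ_iff.1 (mem_range.1 hl)) (by omega)) hu0 hu1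
      · exact hB0
    refine (sum_le_sum hterm).trans (le_of_eq ?_)
    rw [← sum_mul]
    congr 1
    have h := (Nat.sum_range_choose m)
    rw [← Nat.cast_sum]
    exact_mod_cast h
  · rw [abs_zero]; positivity

/-- The unshifted far bound: if every present stencil index `i − l` (`l ≤ m`, `l ≤ i`) is at distance `≥ Λ₁` from
`μ`, then `|coeff_i((1−X)^m·H_{b,d,r})| ≤ 2^m·C(N,r)·exp(u²μ − uΛ₁)` for every `u ∈ [0,1]`.
[cite: Durrett2019, §2.7] [cite: RollinRoss2010, §3 (Lemma 3.1)] -/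
theorem hyperGen_abs_nabla_le_of_far {b d r : ℕ} (hr : r ≤ b + d) (i m : ℕ) {μ Λ₁ u : ℝ}
    (hμ : μ = (r : ℝ) * b / ((b : ℝ) + d)) (hu0 : 0 ≤ u) (hu1 : u ≤ 1)
    (hfar : ∀ l, l ≤ m → l ≤ i → Λ₁ ≤ |(((i - l : ℕ) : ℝ)) - μ|) :
    |((1 - X) ^ m * hyperGen b d r).coeff i| ≤
      2 ^ m * ((((b + d).choose r : ℕ) : ℝ) * Real.exp (u ^ 2 * μ - u * Λ₁)) := by
  have h := hyperGen_abs_nabla_shift_le_of_far hr 0 i m hμ hu0 hu1 (fun l hl hli => by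
    have := hfar l hl (by omega)
    simpa using this)
  simpa using h

end PoissonBinomial

end Literature.Probability.Distributions
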